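import Literature.Barriers.FinalStateConjecture.TrappingDerivativeLossEnergy
import Literature.Geometry.Lorentzian.KerrSchildKillingEnergy
import HarnessLib

/-!
# Sbierski's Kerr trapping theorem: the beam input from quasimodes off the ergoregion, by the
# Killing energy identity (no energy characterisation of Gaussian beams)
(sixth companion file of `Literature/Barriers/FinalStateConjecture/TrappingDerivativeLoss.lean`;
family `gr`, summit `FinalStateConjecture`; namespace `Literature.Barriers.FinalStateConjecture`)

The barrier `SbierskiTrappingObstruction` (Sbierski, Anal. PDE 8 (2015), Thm. 7.4 in the
data-localised reading) is reduced in `TrappingDerivativeLossInputs.lean` /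
`TrappingDerivativeLossEnergy.lean` to (A) the Cauchy problem `KerrSchild.waveCauchyProblem` and
(B) the coordinate-energy beam statement `SbierskiKerrGaussianBeams`: approximate solutions `u`
with data in the ball, `E(u; 0) ≤ C`, `‖□_g u‖²_{L²(R_{[0,T]})} ≤ ε` and local energy
`≥ c > 0` on every leaf `0 ≤ τ ≤ T`, with `c, C` independent of `T`. In the paper the last,
long-time, property comes from the geometric characterisation of the energy of Gaussian beams
(§4). This file proves that on Kerr it already follows from **Sbierski's Thm. 2.1-level
information** — the three conditions of the proof of Thm. 2.1 (arXiv Lemma 5): support in a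
prescribed neighbourhood of the geodesic, `‖□u_λ‖_{L²(R_{[0,T]})} → 0` after normalisation of the
initial energy — for beams along a trapped null geodesic lying **outside the ergoregion**, e.g. the
retrograde equatorial photon orbit `r₀ ∈ [3M, 4M]` (`KerrPhotonOrbit.lean`; the ergoregion is
`{2H > 1} ⊆ {r < 2M}`), by the argument Sbierski gives for globally timelike Killing fields
(§1.2, arXiv p. 6) applied to the *approximate* solution: the `∂_{t*}`-energy density of a
generalised Kerr–Schild background is coercive off `{φ ≥ 1}`
(`KerrSchild.Background.tEnergyDensity_ge`), and the `∂_{t*}`-energy identity with source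
`(□_g u)(∂_{t*} u)` (`KerrSchild.Background.integral_sumSq_lower_bound`) transports the normalised
initial energy of `u` to all leaves `τ ≤ T` up to `δ⁻¹ ε + δ D`, `D` a bound for
`‖∂_{t*} u‖²_{L²(R_{[0,T]})}` fixed before `ε`.

* `SbierskiKerrGaussianBeams.of_quasimodes` — **(B) from quasimodes off the ergoregion**: if for
  `0 < M`, `0 ≤ a ≤ M` there are `R₁` and `φ₀ < 1` such that for every `T ≥ 0` there is `D ≥ 0`
  such that for every `ε > 0` some `W ∈ C^∞(ℝ⁴)` vanishing off a compact subset of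
  `{r > r₊} ∩ {2H ≤ φ₀} ∩ {‖x⃗‖ ≤ R₁}` has `∫ ∑_μ (∂_μ W)²(0, y) dy = 1`,
  `∫_{(0,T]} ∫ (□_g W)² ≤ ε` and `∫_{(0,T]} ∫ (∂_0 W)² ≤ D` (`□_g` the divergence-form Kerr wave
  operator `KerrSchild.waveOperator (Kerr.inverseMetric M a)`, which is the d'Alembertian of
  `Kerr.smoothMetric` on the chart, `Kerr.dalembertian_eq_waveOperator`), then
  `SbierskiKerrGaussianBeams` holds, with `R₀ = R₁`, `C = 1`, `c = (1 − φ₀)/(2 (1 + 4M/r₊))`.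
* `SbierskiTrappingObstruction.of_waveCauchyProblem_of_quasimodes`,
  `SbierskiKerrTrappingLED.of_waveCauchyProblem_of_quasimodes` — the barrier and the print-literal
  theorem from `KerrSchild.waveCauchyProblem` and such quasimodes
  (`SbierskiTrappingObstruction.of_waveCauchyProblem_of_gaussianBeams`).

The quasimode hypothesis is kept as an explicit (inline) hypothesis, not a named fact (D-0026): it
is the content of Sbierski's Thm. 2.1/Lemma 3.2 (arXiv Thm. 1/Lemma 5) for one trapped null
geodesic of Kerr, to be *proved* by the Gaussian-beam construction along the photon orbit
(`KerrSchildWaveOperatorWKB.lean`, `KerrPhotonOrbit*.lean`,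
`Literature/Analysis/ODE/GaussianBeamRiccatiExistence.lean`).

## References

* J. Sbierski, *Characterisation of the energy of Gaussian beams on Lorentzian manifolds: with
  applications to black hole spacetimes*, Anal. PDE 8 (2015) 1379–1420 (arXiv:1311.2477v2): §1.2
  (arXiv p. 6, the remark on timelike Killing fields), proof of Thm. 2.1 with its three conditions
  (arXiv Thm. 1, Lemma 5), Thm. 5.1, Thm. 5.5, §7A, Thm. 7.4 (key `Sbierski2015`).
* M. Dafermos, I. Rodnianski, Y. Shlapentokh-Rothman, arXiv:1402.7034, §2.2.2, §2.3.2
  (key `DafermosRodnianskiShlapentokhrothman2014`).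
-/

noncomputable section

open Set Filter
open scoped Manifold ContDiff ENNReal Topology

namespace Literature.Barriers.FinalStateConjecture

open Literature.Geometry.Lorentzian
open _root_.MeasureTheory Metric

/-! ### Functions on the chart given by a smooth function on `E4` supported inside the chart -/

section Restrict

variable {U : TopologicalSpace.Opens E4} {W : E4 → ℝ} {K : Set E4}

/-- The representative (extension by zero) of the restriction to `U` of a function on `E4` vanishing
off a subset of `U` is the function itself. [folklore] -/
theorem extend_val_restrict_eq (hKU : K ⊆ (U : Set E4)) (hW0 : ∀ x, x ∉ K → W x = 0) :
    Function.extend Subtype.val (fun x : U ↦ W x) (0 : E4 → ℝ) = W := by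
  funext y
  by_cases hy : ∃ z : U, (z : E4) = y
  · obtain ⟨z, rfl⟩ := hy
    exact extend_val_apply (fun x : U ↦ W x) z
  · rw [Function.extend_apply' _ _ _ hy, Pi.zero_apply, eq_comm]
    exact hW0 y fun hyK ↦ hy ⟨⟨y, hKU hyK⟩, rfl⟩

/-- A function on `E4` vanishing off a closed set vanishes identically near every point outside it.
[folklore] -/
theorem eventuallyEq_zero_of_notMem (hK : IsClosed K) (hW0 : ∀ x, x ∉ K → W x = 0) {x : E4}
    (hx : x ∉ K) : W =ᶠ[𝓝 x] fun _ ↦ 0 := by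
  filter_upwards [hK.isOpen_compl.mem_nhds hx] with y hy using hW0 y hy

/-- The derivative of a function vanishing off a closed set vanishes outside it. [folklore] -/
theorem fderiv_eq_zero_of_notMem' (hK : IsClosed K) (hW0 : ∀ x, x ∉ K → W x = 0) {x : E4}
    (hx : x ∉ K) : fderiv ℝ W x = 0 := by
  rw [(eventuallyEq_zero_of_notMem hK hW0 hx).fderiv_eq]
  exact fderiv_const_apply 0

/-- The restriction to the chart of a `C^n` function on `E4` is `C^n` on the chart. [folklore] -/
theorem contMDiff_restrict {n : ℕ∞ω} (hW : ContDiff ℝ n W) :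
    ContMDiff 𝓘(ℝ, E4) 𝓘(ℝ, ℝ) n fun x : U ↦ W x :=
  fun x ↦ (OpensChart.contMDiffAt_iff x (fun x : U ↦ W x) W fun _ ↦ rfl).2 hW.contDiffAt

/-- The preimage in the chart of a compact subset of `E4` contained in the chart is compact.
[folklore] -/
theorem isCompact_preimage_val (hK : IsCompact K) (hKU : K ⊆ (U : Set E4)) :
    IsCompact (Subtype.val ⁻¹' K : Set U) := by
  rw [Topology.IsEmbedding.subtypeVal.isCompact_iff]
  have : Subtype.val '' (Subtype.val ⁻¹' K : Set U) = K := by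
    ext y
    constructor
    · rintro ⟨z, hz, rfl⟩
      exact hz
    · intro hy
      exact ⟨⟨y, hKU hy⟩, hy, rfl⟩
  rwa [this]

/-- The coordinate energy density of the restriction is `∑_μ (∂_μ W)²`. [folklore] -/
theorem coordEnergyDensity_restrict_eq (hKU : K ⊆ (U : Set E4)) (hW0 : ∀ x, x ∉ K → W x = 0)
    (x : E4) :
    coordEnergyDensity U (fun x : U ↦ W x) x = ∑ μ, fderiv ℝ W x (E4.basisVector μ) ^ 2 := by
  simp only [coordEnergyDensity, extend_val_restrict_eq hKU hW0]

/-- **The coordinate energy of the restriction through a leaf is `∫ ∑_μ (∂_μ W)²(τ, y) dy`** (the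
integrand vanishes off the chart). [folklore] -/
theorem sliceEnergy_restrict_eq (hK : IsClosed K) (hKU : K ⊆ (U : Set E4))
    (hW0 : ∀ x, x ∉ K → W x = 0) (τ : ℝ) :
    sliceEnergy U (fun x : U ↦ W x) τ =
      ∫⁻ y : E3, ENNReal.ofReal (∑ μ, fderiv ℝ W (E4.ofTimeSpace τ y) (E4.basisVector μ) ^ 2) := by
  unfold sliceEnergy
  refine lintegral_congr fun y ↦ ?_
  by_cases hy : E4.ofTimeSpace τ y ∈ U
  · rw [Set.indicator_of_mem (show y ∈ {y : E3 | E4.ofTimeSpace τ y ∈ U} from hy),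
      coordEnergyDensity_restrict_eq hKU hW0]
  · rw [Set.indicator_of_notMem (show y ∉ {y : E3 | E4.ofTimeSpace τ y ∈ U} from hy),
      fderiv_eq_zero_of_notMem' hK hW0 (fun h ↦ hy (hKU h))]
    simp

/-- **The local coordinate energy of the restriction equals its full energy** when `K` lies in the
cylinder `{‖x⃗‖ ≤ R}`. [folklore] -/
theorem localSliceEnergy_restrict_eq (hK : IsClosed K) (hKU : K ⊆ (U : Set E4))
    (hW0 : ∀ x, x ∉ K → W x = 0) {R : ℝ} (hKR : ∀ x ∈ K, E4.spatialNorm x ≤ R) (τ : ℝ) :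
    localSliceEnergy U (fun x : U ↦ W x) τ R =
      ∫⁻ y : E3, ENNReal.ofReal (∑ μ, fderiv ℝ W (E4.ofTimeSpace τ y) (E4.basisVector μ) ^ 2) := by
  rw [← sliceEnergy_restrict_eq hK hKU hW0 τ]
  unfold localSliceEnergy sliceEnergy
  rw [← lintegral_indicator measurableSet_closedBall]
  refine lintegral_congr fun y ↦ ?_
  by_cases hy : y ∈ closedBall (0 : E3) R
  · rw [Set.indicator_of_mem hy]
  · rw [Set.indicator_of_notMem hy]
    have hyK : E4.ofTimeSpace τ y ∉ K := by
      intro h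
      have := hKR _ h
      rw [E4.spatialNorm_ofTimeSpace] at this
      exact hy (mem_closedBall_zero_iff.2 this)
    by_cases hyU : E4.ofTimeSpace τ y ∈ U
    · rw [Set.indicator_of_mem (show y ∈ {y : E3 | E4.ofTimeSpace τ y ∈ U} from hyU),
        coordEnergyDensity_restrict_eq hKU hW0, fderiv_eq_zero_of_notMem' hK hW0 hyK]
      simp
    · rw [Set.indicator_of_notMem (show y ∉ {y : E3 | E4.ofTimeSpace τ y ∈ U} from hyU)]

end Restrict

/-! ### The Kerr wave operator of a function supported inside the exterior chart -/

section KerrChartNoFacts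

variable {M a : ℝ} {W : E4 → ℝ} {K : Set E4}

/-- The Kerr wave operator of a function vanishing off a closed set vanishes outside it.
[folklore] -/
theorem waveOperator_eq_zero_of_notMem (hK : IsClosed K) (hW0 : ∀ x, x ∉ K → W x = 0) {x : E4}
    (hx : x ∉ K) : KerrSchild.waveOperator (Kerr.inverseMetric M a) W x = 0 :=
  KerrSchild.waveOperator_eq_zero_of_eventuallyEq_zero
    ((eventuallyEq_zero_of_notMem hK hW0 hx).trans (by rfl))

/-- **The surgered background has the Kerr wave operator on functions supported inside the
chart** (locality in the coefficients near chart points, `Kerr.surgeryBackground_inverseMetric_eventuallyEq`;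
both sides vanish elsewhere). [cite: KerrSchild1965, §2] -/
theorem waveOperator_surgeryBackground_eq (hM : 0 < M) (hK : IsClosed K)
    (hKU : K ⊆ (Kerr.exterior M a : Set E4)) (hW0 : ∀ x, x ∉ K → W x = 0) (x : E4) :
    KerrSchild.waveOperator (Kerr.surgeryBackground M a (Kerr.rPlus M a) hM.le
        (rPlus_pos_of_pos hM a)).inverseMetric W x =
      KerrSchild.waveOperator (Kerr.inverseMetric M a) W x := by
  by_cases hx : x ∈ K
  · have h1 := KerrSchild.waveOperator_congr_of_eventuallyEq
      (Kerr.surgeryBackground_inverseMetric_eventuallyEq M a hM.le (rPlus_pos_of_pos hM a)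
        ⟨x, hKU hx⟩) W
    rw [← h1]
    congr 1
    funext y μ ν
    exact (Kerr.inverseMetric_eq_kerrSchild M a y μ ν).symm
  · rw [waveOperator_eq_zero_of_notMem hK hW0 hx]
    exact KerrSchild.waveOperator_eq_zero_of_eventuallyEq_zero
      ((eventuallyEq_zero_of_notMem hK hW0 hx).trans (by rfl))

end KerrChartNoFacts

section KerrChart

variable [Kerr.Facts] [Kerr.SliceFacts] {M a : ℝ} {W : E4 → ℝ} {K : Set E4}

/-- **On the chart the d'Alembertian of the restriction is the divergence-form Kerr wave
operator of `W`** (`Kerr.dalembertian_eq_waveOperator`, `Kerr.inverseMetric_eq_kerrSchild`).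
[cite: KerrSchild1965, §2] -/
theorem dalembertian_restrict_eq (hW : ContDiff ℝ 2 W) (x : Kerr.exterior M a) :
    (Kerr.smoothMetric M a (Kerr.rPlus M a)).toPseudoRiemannianMetric.dalembertian
        (fun x : Kerr.exterior M a ↦ W x) x =
      KerrSchild.waveOperator (Kerr.inverseMetric M a) W x := by
  refine (Kerr.dalembertian_eq_waveOperator M a (Kerr.rPlus M a) (ψ := fun x ↦ W x) (Φ := W)
    (fun _ ↦ rfl) x hW.contDiffAt).trans ?_
  congr 1
  funext y μ ν
  exact (Kerr.inverseMetric_eq_kerrSchild M a y μ ν).symm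

/-- **The slab norm of `□_g` of the restriction is the slab integral of `(□_G W)²`** (off the chart
both vanish). [folklore] -/
theorem slabSqNorm_dalembertian_restrict_eq (hW : ContDiff ℝ 2 W) (hK : IsClosed K)
    (hKU : K ⊆ (Kerr.exterior M a : Set E4)) (hW0 : ∀ x, x ∉ K → W x = 0) (T : ℝ) :
    slabSqNorm (Kerr.exterior M a) (fun x ↦
        (Kerr.smoothMetric M a (Kerr.rPlus M a)).toPseudoRiemannianMetric.dalembertian
          (fun x : Kerr.exterior M a ↦ W x) x) T =
      ∫⁻ x in {x : E4 | x 0 ∈ Set.Icc 0 T},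
        ENNReal.ofReal (KerrSchild.waveOperator (Kerr.inverseMetric M a) W x ^ 2) := by
  unfold slabSqNorm
  have hmeas : MeasurableSet {x : E4 | x 0 ∈ Set.Icc 0 T} :=
    (E4.dx 0).continuous.measurable measurableSet_Icc
  rw [← lintegral_indicator hmeas]
  refine lintegral_congr fun x ↦ ?_
  by_cases hxU : x ∈ (Kerr.exterior M a : Set E4)
  · have hrep : Function.extend Subtype.val (fun z : Kerr.exterior M a ↦
        (Kerr.smoothMetric M a (Kerr.rPlus M a)).toPseudoRiemannianMetric.dalembertian
          (fun x : Kerr.exterior M a ↦ W x) z) (0 : E4 → ℝ) x =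
        KerrSchild.waveOperator (Kerr.inverseMetric M a) W x := by
      rw [show x = ((⟨x, hxU⟩ : Kerr.exterior M a) : E4) from rfl, extend_val_apply]
      exact dalembertian_restrict_eq hW ⟨x, hxU⟩
    by_cases hxT : x 0 ∈ Set.Icc 0 T
    · rw [Set.indicator_of_mem (show x ∈ {x : E4 | x ∈ (Kerr.exterior M a : Set E4) ∧
          0 ≤ x 0 ∧ x 0 ≤ T} from ⟨hxU, hxT.1, hxT.2⟩),
        Set.indicator_of_mem (show x ∈ {x : E4 | x 0 ∈ Set.Icc 0 T} from hxT), hrep]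
    · rw [Set.indicator_of_notMem (show x ∉ {x : E4 | x ∈ (Kerr.exterior M a : Set E4) ∧
          0 ≤ x 0 ∧ x 0 ≤ T} from fun h ↦ hxT ⟨h.2.1, h.2.2⟩),
        Set.indicator_of_notMem (show x ∉ {x : E4 | x 0 ∈ Set.Icc 0 T} from hxT)]
  · rw [Set.indicator_of_notMem (show x ∉ {x : E4 | x ∈ (Kerr.exterior M a : Set E4) ∧
        0 ≤ x 0 ∧ x 0 ≤ T} from fun h ↦ hxU h.1)]
    by_cases hxT : x 0 ∈ Set.Icc 0 T
    · rw [Set.indicator_of_mem (show x ∈ {x : E4 | x 0 ∈ Set.Icc 0 T} from hxT),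
        waveOperator_eq_zero_of_notMem hK hW0 (fun h ↦ hxU (hKU h))]
      simp
    · rw [Set.indicator_of_notMem (show x ∉ {x : E4 | x 0 ∈ Set.Icc 0 T} from hxT)]

end KerrChart

/-! ### Real and `[0, ∞]`-valued slice and slab integrals -/

section Conversions

/-- **A slice `lintegral` of a continuous nonnegative integrand vanishing off a ball is the real
integral.** [folklore] -/
theorem lintegral_slice_eq_ofReal {F : E4 → ℝ} (hF : Continuous F) (hF0 : ∀ x, 0 ≤ F x)
    {τ ρ : ℝ} (hvan : ∀ y : E3, ρ < ‖y‖ → F (E4.ofTimeSpace τ y) = 0) :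
    ∫⁻ y : E3, ENNReal.ofReal (F (E4.ofTimeSpace τ y)) = ENNReal.ofReal (∫ y, F (E4.ofTimeSpace τ y)) := by
  have hc : HasCompactSupport fun y : E3 ↦ F (E4.ofTimeSpace τ y) := by
    refine HasCompactSupport.intro (isCompact_closedBall (0 : E3) ρ) fun y hy ↦ hvan y ?_
    rwa [mem_closedBall, dist_zero_right, not_le] at hy
  have hint : Integrable fun y : E3 ↦ F (E4.ofTimeSpace τ y) :=
    (hF.comp (E4.continuous_ofTimeSpace τ)).integrable_of_hasCompactSupport hc
  exact (ofReal_integral_eq_lintegral_ofReal hint (ae_of_all _ fun y ↦ hF0 _)).symm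

/-- **A slab `lintegral` of a continuous nonnegative integrand vanishing off a cylinder is the
real iterated integral** (Tonelli in `(t, y)`, `E4.setLIntegral_timeSlab_eq`). [folklore] -/
theorem setLIntegral_slab_eq_ofReal {F : E4 → ℝ} (hF : Continuous F) (hF0 : ∀ x, 0 ≤ F x)
    {T ρ : ℝ} (hvan : ∀ t ∈ Set.Icc 0 T, ∀ y : E3, ρ < ‖y‖ → F (E4.ofTimeSpace t y) = 0) :
    ∫⁻ x in {x : E4 | x 0 ∈ Set.Icc 0 T}, ENNReal.ofReal (F x) =
      ENNReal.ofReal (∫ t in Set.Ioc 0 T, ∫ y, F (E4.ofTimeSpace t y)) := by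
  rw [E4.setLIntegral_timeSlab_eq (fun x ↦ ENNReal.ofReal (F x))
    (ENNReal.measurable_ofReal.comp hF.measurable) measurableSet_Icc]
  -- the slice integrals are ball integrals for `t ∈ [0, T]`, hence continuous in `t` there
  have hball : ∀ t ∈ Set.Icc 0 T,
      ∫ y, F (E4.ofTimeSpace t y) = ∫ y in closedBall (0 : E3) ρ, F (E4.ofTimeSpace t y) := by
    intro t ht
    refine (setIntegral_eq_integral_of_forall_compl_eq_zero fun y hy ↦ hvan t ht y ?_).symm
    rwa [mem_closedBall, dist_zero_right, not_le] at hy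
  have hcont : ContinuousOn (fun t ↦ ∫ y, F (E4.ofTimeSpace t y)) (Set.Icc 0 T) :=
    (KerrSchild.Background.continuous_ballIntegral hF ρ).continuousOn.congr fun t ht ↦ hball t ht
  have hnn : ∀ t, 0 ≤ ∫ y, F (E4.ofTimeSpace t y) := fun t ↦ integral_nonneg fun y ↦ hF0 _
  calc ∫⁻ t in Set.Icc 0 T, ∫⁻ y, ENNReal.ofReal (F (E4.ofTimeSpace t y))
      = ∫⁻ t in Set.Icc 0 T, ENNReal.ofReal (∫ y, F (E4.ofTimeSpace t y)) :=
        setLIntegral_congr_fun measurableSet_Icc fun t ht ↦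
          lintegral_slice_eq_ofReal hF hF0 (hvan t ht)
    _ = ENNReal.ofReal (∫ t in Set.Icc 0 T, ∫ y, F (E4.ofTimeSpace t y)) :=
        (ofReal_integral_eq_lintegral_ofReal hcont.integrableOn_Icc
          (ae_of_all _ fun t ↦ hnn t)).symm
    _ = ENNReal.ofReal (∫ t in Set.Ioc 0 T, ∫ y, F (E4.ofTimeSpace t y)) := by
        rw [integral_Icc_eq_integral_Ioc]

end Conversions

/-! ### Stationarity of the surgered background -/

/-- **The surgered Kerr background is stationary**: `∂_0 g^{αβ} = 0`
(`Kerr.surgeryBackground_inverseMetric_add_smul_basisVector_zero`). [cite: KerrSchild1965, §2] -/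
theorem fderiv_surgeryBackground_inverseMetric_basisVector_zero {M : ℝ} (hM : 0 ≤ M) (a : ℝ)
    {r₀ : ℝ} (hr₀ : 0 < r₀) (x : E4) (α β : Fin 4) :
    fderiv ℝ (fun y ↦ (Kerr.surgeryBackground M a r₀ hM hr₀).inverseMetric y α β) x
      (E4.basisVector 0) = 0 := by
  set g : E4 → ℝ := fun y ↦ (Kerr.surgeryBackground M a r₀ hM hr₀).inverseMetric y α β with hg
  have hgd : DifferentiableAt ℝ g x :=
    (((Kerr.surgeryBackground M a r₀ hM hr₀).contDiff_inverseMetric α β).differentiable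
      (by simp)).differentiableAt
  have h1 : HasDerivAt (fun t : ℝ ↦ g (x + t • E4.basisVector 0))
      (fderiv ℝ g x (E4.basisVector 0)) 0 :=
    hgd.hasFDerivAt.hasLineDerivAt (E4.basisVector 0)
  have hconst : (fun t : ℝ ↦ g (x + t • E4.basisVector 0)) = fun _ ↦ g x :=
    funext fun t ↦ Kerr.surgeryBackground_inverseMetric_add_smul_basisVector_zero hM a hr₀ x t α β
  rw [hconst] at h1
  exact h1.unique (hasDerivAt_const 0 (g x))

/-! ### (B) from quasimodes off the ergoregion -/

/-- **Sbierski's Gaussian-beam input from quasimodes off the ergoregion, by the Killing energy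
identity.** Suppose that for `0 < M`, `0 ≤ a ≤ M` there are `R₁` and `φ₀ < 1` such that for
every `T ≥ 0` there is `D ≥ 0` such that for every `ε > 0` some `W ∈ C^∞(ℝ⁴)`, vanishing off a
compact subset of `{r > r₊} ∩ {2H ≤ φ₀} ∩ {‖x⃗‖ ≤ R₁}` of the Kerr–Schild chart, has normalised
initial coordinate energy `∫ ∑_μ (∂_μ W)²(0, y) dy = 1`, `∫_{(0,T]} ∫ (□_g W)² dy dt ≤ ε` for the
divergence-form Kerr wave operator `□_g = ∂_μ g^{μν} ∂_ν` (`= □` of `Kerr.smoothMetric` on the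
chart), and `∫_{(0,T]} ∫ (∂_0 W)² dy dt ≤ D` (Sbierski, Anal. PDE 8 (2015), the three conditions
of the proof of Thm. 2.1 [arXiv Thm. 1 / Lemma 5] for a Gaussian beam along a trapped null
geodesic of the Kerr exterior lying off the ergoregion, §7A, after normalisation and a cut-off in
`t*`). Then the coordinate-energy beam statement `SbierskiKerrGaussianBeams` holds, with
`R₀ = R₁`, `C = 1` and `c = (1 − φ₀)/(2 (1 + 4M/r₊))`: the `∂_{t*}`-energy of `W` — coercive on
its support, `e ≥ ½ (1 − 2H) ∑ (∂W)²` — is transported from `{t* = 0}` to `{t* = τ}`, `τ ≤ T`,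
by the Killing energy identity up to `δ⁻¹ ε + δ D ≤ (1 − φ₀)/2`
(`KerrSchild.Background.integral_sumSq_lower_bound` on the stationary surgered background, whose
wave operator is `□_g` on such `W`), which is Sbierski's remark of §1.2 (arXiv p. 6) on globally
timelike Killing fields applied to the approximate solution.
[cite: Sbierski2015, §1.2 (arXiv p. 6), §2 proof of Thm. 2.1, §7A] -/
theorem SbierskiKerrGaussianBeams.of_quasimodes
    (hQ : ∀ (M a : ℝ), 0 < M → 0 ≤ a → a ≤ M →
      ∃ R₁ φ₀ : ℝ, φ₀ < 1 ∧ ∀ T : ℝ, 0 ≤ T → ∃ D : ℝ, 0 ≤ D ∧ ∀ ε : ℝ, 0 < ε →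
        ∃ W : E4 → ℝ, ContDiff ℝ ∞ W ∧
          (∃ K : Set E4, IsCompact K ∧
            K ⊆ {x | x ∈ (Kerr.exterior M a : Set E4) ∧ 2 * Kerr.scalarH M a x ≤ φ₀ ∧
              E4.spatialNorm x ≤ R₁} ∧ ∀ x, x ∉ K → W x = 0) ∧
          (∫ y, ∑ μ, fderiv ℝ W (E4.ofTimeSpace 0 y) (E4.basisVector μ) ^ 2) = 1 ∧
          (∫ t in Set.Ioc 0 T, ∫ y,
              KerrSchild.waveOperator (Kerr.inverseMetric M a) W (E4.ofTimeSpace t y) ^ 2) ≤ ε ∧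
          (∫ t in Set.Ioc 0 T, ∫ y,
              fderiv ℝ W (E4.ofTimeSpace t y) (E4.basisVector 0) ^ 2) ≤ D) :
    SbierskiKerrGaussianBeams := by
  intro _ _ M a hM ha₀ haM
  obtain ⟨R₁, φ₀, hφ₀, hQT⟩ := hQ M a hM ha₀ haM
  refine ⟨R₁, fun R hR ↦ ?_⟩
  have hrp : 0 < Kerr.rPlus M a := rPlus_pos_of_pos hM a
  set B := Kerr.surgeryBackground M a (Kerr.rPlus M a) hM.le hrp with hB
  have hΦ : B.bound = 4 * M / Kerr.rPlus M a := rfl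
  have hΦ0 : 0 ≤ B.bound := by rw [hΦ]; positivity
  have hstat : ∀ x α β, fderiv ℝ (fun y ↦ B.inverseMetric y α β) x (E4.basisVector 0) = 0 :=
    fun x α β ↦ fderiv_surgeryBackground_inverseMetric_basisVector_zero hM.le a hrp x α β
  have h1φ : 0 < 1 - φ₀ := by linarith
  set c : ℝ := (1 - φ₀) / (2 * (1 + B.bound)) with hc
  have hc0 : 0 < c := by positivity
  refine ⟨c, 1, hc0, fun T hT ε hε ↦ ?_⟩
  obtain ⟨D, hD0, hQε⟩ := hQT T hT
  set δ : ℝ := (1 - φ₀) / (4 * (D + 1)) with hδ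
  have hδ0 : 0 < δ := by positivity
  set ε' : ℝ := min ε (δ * (1 - φ₀) / 4) with hε'
  have hε'0 : 0 < ε' := lt_min hε (by positivity)
  obtain ⟨W, hW, ⟨K, hK, hKsub, hW0⟩, hE1, hbox, hdt⟩ := hQε ε' hε'0
  have hW2 : ContDiff ℝ 2 W := hW.of_le (by norm_cast)
  have hKc : IsClosed K := hK.isClosed
  have hKU : K ⊆ (Kerr.exterior M a : Set E4) := fun x hx ↦ (hKsub hx).1
  have hKφ : ∀ x ∈ K, 2 * Kerr.scalarH M a x ≤ φ₀ := fun x hx ↦ (hKsub hx).2.1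
  have hKR : ∀ x ∈ K, E4.spatialNorm x ≤ R₁ := fun x hx ↦ (hKsub hx).2.2
  have hdW0 : ∀ x, x ∉ K → fderiv ℝ W x = 0 := fun x hx ↦ fderiv_eq_zero_of_notMem' hKc hW0 hx
  -- vanishing outside the cylinder of radius `R₁`, at all times
  have hfarK : ∀ x : E4, R₁ < E4.spatialNorm x → x ∉ K := fun x hx hxK ↦
    (not_le.2 hx) (hKR x hxK)
  have hsupp : ∀ x : E4, -1 < x 0 → x 0 < T + 1 → R₁ < E4.spatialNorm x → W x = 0 :=
    fun x _ _ hx ↦ hW0 x (hfarK x hx)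
  -- notation for the integrands
  set s : E4 → ℝ := fun x ↦ ∑ μ, fderiv ℝ W x (E4.basisVector μ) ^ 2 with hs
  set q : E4 → ℝ := fun x ↦ KerrSchild.waveOperator (Kerr.inverseMetric M a) W x ^ 2 with hq
  have hqB : ∀ x, KerrSchild.waveOperator B.inverseMetric W x =
      KerrSchild.waveOperator (Kerr.inverseMetric M a) W x :=
    fun x ↦ waveOperator_surgeryBackground_eq hM hKc hKU hW0 x
  have hsc : Continuous s := KerrSchild.Background.continuous_sumSq hW2
  have hqc : Continuous q := by
    have : q = fun x ↦ KerrSchild.waveOperator B.inverseMetric W x ^ 2 := by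
      funext x; simp [hq, hqB]
    rw [this]
    exact (B.continuous_waveOperator hW2).pow 2
  have hs0 : ∀ x, 0 ≤ s x := fun x ↦ Finset.sum_nonneg fun _ _ ↦ sq_nonneg _
  have hq0 : ∀ x, 0 ≤ q x := fun x ↦ sq_nonneg _
  have hnotK : ∀ (τ : ℝ) (y : E3), R₁ < ‖y‖ → E4.ofTimeSpace τ y ∉ K := fun τ y hy ↦
    hfarK _ (by rwa [E4.spatialNorm_ofTimeSpace])
  have hsvan : ∀ (τ : ℝ) (y : E3), R₁ < ‖y‖ → s (E4.ofTimeSpace τ y) = 0 := by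
    intro τ y hy
    have h0 : fderiv ℝ W (E4.ofTimeSpace τ y) = 0 := hdW0 _ (hnotK τ y hy)
    simp only [hs, h0]
    simp
  have hqvan : ∀ (τ : ℝ) (y : E3), R₁ < ‖y‖ → q (E4.ofTimeSpace τ y) = 0 := by
    intro τ y hy
    have h0 : KerrSchild.waveOperator (Kerr.inverseMetric M a) W (E4.ofTimeSpace τ y) = 0 :=
      waveOperator_eq_zero_of_notMem hKc hW0 (hnotK τ y hy)
    simp only [hq, h0]
    simp
  -- ### the Killing energy transfer on the surgered background
  have hlow : ∀ τ : ℝ, 0 ≤ τ → τ ≤ T →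
      c ≤ ∫ y, ∑ μ, fderiv ℝ W (E4.ofTimeSpace τ y) (E4.basisVector μ) ^ 2 := by
    intro τ hτ0 hτT
    have hφ₀' : ∀ y : E3, B.φ (E4.ofTimeSpace 0 y) ≤ φ₀ ∨ fderiv ℝ W (E4.ofTimeSpace 0 y) = 0 := by
      intro y
      by_cases hy : E4.ofTimeSpace 0 y ∈ K
      · left
        have hyU := hKU hy
        have hr : Kerr.rPlus M a ≤ Kerr.radius a (E4.ofTimeSpace 0 y) :=
          (Kerr.lt_radius_of_mem_region hyU).le
        rw [hB, Kerr.surgeryBackground_φ, Kerr.surgeryProfile_eq_of_le hrp hr]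
        exact hKφ _ hy
      · exact Or.inr (hdW0 _ hy)
    have hL := B.integral_sumSq_lower_bound hstat hW2 hδ0 (T := T) (ρ := R₁) (φ₀ := φ₀)
      hsupp hφ₀' hτ0 hτT
    have hqI : (∫ t in Set.Ioc 0 T, ∫ y,
        KerrSchild.waveOperator B.inverseMetric W (E4.ofTimeSpace t y) ^ 2) =
        ∫ t in Set.Ioc 0 T, ∫ y,
          KerrSchild.waveOperator (Kerr.inverseMetric M a) W (E4.ofTimeSpace t y) ^ 2 := by
      congr 1
      funext t
      congr 1
      funext y
      rw [hqB]
    rw [hqI, hE1, mul_one] at hL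
    -- the two error terms
    have hq_le : (∫ t in Set.Ioc 0 T, ∫ y,
        KerrSchild.waveOperator (Kerr.inverseMetric M a) W (E4.ofTimeSpace t y) ^ 2) ≤
        δ * (1 - φ₀) / 4 := hbox.trans (min_le_right _ _)
    have h1 : δ⁻¹ * (∫ t in Set.Ioc 0 T, ∫ y,
        KerrSchild.waveOperator (Kerr.inverseMetric M a) W (E4.ofTimeSpace t y) ^ 2) ≤
        (1 - φ₀) / 4 := by
      calc δ⁻¹ * (∫ t in Set.Ioc 0 T, ∫ y,
            KerrSchild.waveOperator (Kerr.inverseMetric M a) W (E4.ofTimeSpace t y) ^ 2)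
          ≤ δ⁻¹ * (δ * (1 - φ₀) / 4) := mul_le_mul_of_nonneg_left hq_le (inv_pos.2 hδ0).le
        _ = (1 - φ₀) / 4 := by field_simp
    have h2 : δ * (∫ t in Set.Ioc 0 T, ∫ y,
        fderiv ℝ W (E4.ofTimeSpace t y) (E4.basisVector 0) ^ 2) ≤ (1 - φ₀) / 4 := by
      have hDD : D / (D + 1) ≤ 1 := by
        rw [div_le_one (by positivity)]
        linarith
      calc δ * (∫ t in Set.Ioc 0 T, ∫ y, fderiv ℝ W (E4.ofTimeSpace t y) (E4.basisVector 0) ^ 2)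
          ≤ δ * D := mul_le_mul_of_nonneg_left hdt hδ0.le
        _ = (1 - φ₀) / 4 * (D / (D + 1)) := by rw [hδ]; field_simp
        _ ≤ (1 - φ₀) / 4 * 1 := mul_le_mul_of_nonneg_left hDD (by positivity)
        _ = (1 - φ₀) / 4 := mul_one _
    have hΦ1 : 0 < 1 + B.bound := by positivity
    have key : (1 - φ₀) / 2 ≤
        (1 + B.bound) * ∫ y, ∑ μ, fderiv ℝ W (E4.ofTimeSpace τ y) (E4.basisVector μ) ^ 2 := by
      linarith
    rw [hc, div_le_iff₀ (by positivity)]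
    nlinarith [key]
  -- ### the function on the chart and its properties
  refine ⟨fun x ↦ W x, contMDiff_restrict hW,
    ⟨Subtype.val ⁻¹' K, isCompact_preimage_val hK hKU, fun x hx ↦ hW0 x hx⟩,
    fun x hx0 hxR ↦ ?_, ?_, ?_, fun τ hτ0 hτT ↦ ?_⟩
  · -- data vanish outside the ball `R ≥ R₁`
    have hxK : (x : E4) ∉ K := hfarK _ (hR.trans_lt hxR)
    refine ⟨hW0 _ hxK, ?_⟩
    rw [OpensChart.mfderiv_eq x (fun x ↦ W x) W (fun _ ↦ rfl)
      ((hW.differentiable (by simp)).differentiableAt), hdW0 _ hxK]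
    rfl
  · -- initial energy `= 1`
    rw [sliceEnergy_restrict_eq hKc hKU hW0 0]
    have h := lintegral_slice_eq_ofReal hsc hs0 (hsvan 0)
    simp only [hs] at h
    rw [h]
    exact ENNReal.ofReal_le_ofReal hE1.le
  · -- `‖□_g u‖²_{L²(R_{[0,T]})} ≤ ε`
    rw [slabSqNorm_dalembertian_restrict_eq hW2 hKc hKU hW0 T]
    have h := setLIntegral_slab_eq_ofReal hqc hq0 (T := T) (fun t _ y hy ↦ hqvan t y hy)
    simp only [hq] at h
    rw [h]
    exact ENNReal.ofReal_le_ofReal (hbox.trans (min_le_left _ _))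
  · -- lower bound on the local energy
    rw [localSliceEnergy_restrict_eq hKc hKU hW0 (fun x hx ↦ (hKR x hx).trans hR) τ]
    have h := lintegral_slice_eq_ofReal hsc hs0 (hsvan τ)
    simp only [hs] at h
    rw [h]
    exact ENNReal.ofReal_le_ofReal (hlow τ hτ0 hτT)

/-! ### The barrier from the Cauchy problem and quasimodes -/

/-- **The barrier `SbierskiTrappingObstruction` from `KerrSchild.waveCauchyProblem` and quasimodes
off the ergoregion** (Sbierski, Anal. PDE 8 (2015), Thm. 7.4 in the data-localised reading:
`SbierskiTrappingObstruction.of_waveCauchyProblem_of_gaussianBeams` with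
`SbierskiKerrGaussianBeams.of_quasimodes`). [cite: Sbierski2015, Thm. 7.4 with Thm. 5.5, Thm. 5.1, §2 and §7A] -/
theorem SbierskiTrappingObstruction.of_waveCauchyProblem_of_quasimodes
    (h : KerrSchild.waveCauchyProblem)
    (hQ : ∀ (M a : ℝ), 0 < M → 0 ≤ a → a ≤ M →
      ∃ R₁ φ₀ : ℝ, φ₀ < 1 ∧ ∀ T : ℝ, 0 ≤ T → ∃ D : ℝ, 0 ≤ D ∧ ∀ ε : ℝ, 0 < ε →
        ∃ W : E4 → ℝ, ContDiff ℝ ∞ W ∧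
          (∃ K : Set E4, IsCompact K ∧
            K ⊆ {x | x ∈ (Kerr.exterior M a : Set E4) ∧ 2 * Kerr.scalarH M a x ≤ φ₀ ∧
              E4.spatialNorm x ≤ R₁} ∧ ∀ x, x ∉ K → W x = 0) ∧
          (∫ y, ∑ μ, fderiv ℝ W (E4.ofTimeSpace 0 y) (E4.basisVector μ) ^ 2) = 1 ∧
          (∫ t in Set.Ioc 0 T, ∫ y,
              KerrSchild.waveOperator (Kerr.inverseMetric M a) W (E4.ofTimeSpace t y) ^ 2) ≤ ε ∧
          (∫ t in Set.Ioc 0 T, ∫ y,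
              fderiv ℝ W (E4.ofTimeSpace t y) (E4.basisVector 0) ^ 2) ≤ D) :
    SbierskiTrappingObstruction :=
  SbierskiTrappingObstruction.of_waveCauchyProblem_of_gaussianBeams h
    (SbierskiKerrGaussianBeams.of_quasimodes hQ)

/-- **The print-literal Thm. 7.4, `SbierskiKerrTrappingLED`, from `KerrSchild.waveCauchyProblem` and
quasimodes off the ergoregion** (through the barrier and `SbierskiTrappingObstruction.literal`).
[cite: Sbierski2015, Thm. 7.4] -/
theorem SbierskiKerrTrappingLED.of_waveCauchyProblem_of_quasimodes
    (h : KerrSchild.waveCauchyProblem)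
    (hQ : ∀ (M a : ℝ), 0 < M → 0 ≤ a → a ≤ M →
      ∃ R₁ φ₀ : ℝ, φ₀ < 1 ∧ ∀ T : ℝ, 0 ≤ T → ∃ D : ℝ, 0 ≤ D ∧ ∀ ε : ℝ, 0 < ε →
        ∃ W : E4 → ℝ, ContDiff ℝ ∞ W ∧
          (∃ K : Set E4, IsCompact K ∧
            K ⊆ {x | x ∈ (Kerr.exterior M a : Set E4) ∧ 2 * Kerr.scalarH M a x ≤ φ₀ ∧
              E4.spatialNorm x ≤ R₁} ∧ ∀ x, x ∉ K → W x = 0) ∧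
          (∫ y, ∑ μ, fderiv ℝ W (E4.ofTimeSpace 0 y) (E4.basisVector μ) ^ 2) = 1 ∧
          (∫ t in Set.Ioc 0 T, ∫ y,
              KerrSchild.waveOperator (Kerr.inverseMetric M a) W (E4.ofTimeSpace t y) ^ 2) ≤ ε ∧
          (∫ t in Set.Ioc 0 T, ∫ y,
              fderiv ℝ W (E4.ofTimeSpace t y) (E4.basisVector 0) ^ 2) ≤ D) :
    SbierskiKerrTrappingLED :=
  SbierskiTrappingObstruction.literal
    (SbierskiTrappingObstruction.of_waveCauchyProblem_of_quasimodes h hQ)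

end Literature.Barriers.FinalStateConjecture

end
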